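import Summits.SmoothPoincare4.SmoothPoincare4.Theorems.SullivanDualHyperbolicEndTaubesModelDefs

/-!
# Route `SullivanDual`, crux `HyperbolicEnd` (stmt-SmoothPoincare4-7825), line `taubes-circle-pencil`:
# closedness `dωT = 0` of Taubes' untwisted model form

Registered helper `helper_taubesForm_closed` of the checked skeleton: at every point `y` of a flat
Taubes tube `taubesTube δ`, `0 < δ < 1`, and for constant vector fields `u, v, w` on `ℝ⁴`,
`(dωT)(u, v, w) = ∂_u ωT(v, w) − ∂_v ωT(u, w) + ∂_w ωT(u, v) = 0`, written with `fderiv` of the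
explicit formula `taubesForm` of `Theorems/SullivanDualHyperbolicEndTaubesModelDefs.lean`
(Taubes, Geom. Topol. 2 (1998), §1: `ωT = dt ∧ dQ + ⋆₃ dQ` with `Q = ½(a² + b² − 2c²)` harmonic for
`g_tor`, so `ωT` is closed; no hypothesis `y ∉ taubesCore` is needed, `ωT` is smooth across the core).

Method.  On the tube `r = taubesR y > 0` (`δ < 1`), so every building block of `taubesForm` —
the coordinates `xᵢ`, `r = √(x₀² + x₁²)`, `dt(v) = (x₀v₁ − x₁v₀)/r²`, `da(v) = (x₀v₀ + x₁v₁)/r`,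
`dQ(v) = (r − 1) da(v) + x₂v₂ − 2x₃v₃` — is Fréchet differentiable at `y` (chain rule with `√` and
`⁻¹` away from `0`).  We compute `∂_u r = da(u)` and explicit formulas for `∂_u dt(v)`, `∂_u da(v)`,
`∂_u dQ(v)`, and read off the three symmetries `∂_u dt(v) = ∂_v dt(u)` (`dt = d arg(x₀ + ix₁)` is
closed), `∂_u da(v) = ∂_v da(u)` (`da = dr` is exact), `∂_u dQ(v) = ∂_v dQ(u)` (`dQ` is exact).  The
product rule expresses `∂_u ωT(v, w)` through these block derivatives, and the cyclic sum is then an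
explicit linear combination of the three symmetries (the `dt ∧ dQ` part) plus the identity
`da∧db∧dc + db∧dc∧da − 2 dc∧da∧db = 0` for the `⋆₃dQ = a db∧dc + b dc∧da − 2c da∧db` part, closed by
`linear_combination`.
-/

-- the registered namespace `Summit.SmoothPoincare4.SmoothPoincare4.…` repeats a component (P = Sub)
set_option linter.dupNamespace false

noncomputable section

namespace Summit.SmoothPoincare4.SmoothPoincare4.Cruxes.HyperbolicEnd.TaubesCirclePencil

/-! ### Derivatives of the building blocks off the axis -/

/-- On a tube of radius `< 1` the distance from the axis is positive (private copy of the sibling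
identities file's lemma). [folklore] -/
private theorem closed_taubesR_pos (δ : ℝ) (y : EuclideanSpace ℝ (Fin 4)) (hδ0 : 0 < δ)
    (hδ : δ < 1) (hy : y ∈ taubesTube δ) : 0 < taubesR y := by
  rw [mem_taubesTube] at hy
  by_contra h
  have h0 : taubesR y = 0 := le_antisymm (not_lt.mp h) (Real.sqrt_nonneg _)
  have h1 : (1 : ℝ) ≤ (taubesR y - 1) ^ 2 + y 2 ^ 2 + y 3 ^ 2 := by
    rw [h0]; nlinarith [sq_nonneg (y 2), sq_nonneg (y 3)]
  nlinarith [hδ0, hδ, h1, hy]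

/-- The coordinate functions `x ↦ xᵢ` are differentiable with derivative the projection. [folklore] -/
private theorem closed_hasFDerivAt_coord (i : Fin 4) (y : EuclideanSpace ℝ (Fin 4)) :
    HasFDerivAt (fun x : EuclideanSpace ℝ (Fin 4) => x i)
      (PiLp.proj (𝕜 := ℝ) 2 (fun _ : Fin 4 => ℝ) i) y :=
  PiLp.hasFDerivAt_apply 2 y i

/-- Off the axis, `r = √(x₀² + x₁²)` is differentiable with `∂_u r = da(u)`. [folklore] -/
private theorem closed_fderiv_taubesR (y : EuclideanSpace ℝ (Fin 4)) (hr : 0 < taubesR y) :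
    DifferentiableAt ℝ taubesR y ∧ ∀ u, fderiv ℝ taubesR y u = taubesDa y u := by
  have hr0 : Real.sqrt (y 0 ^ 2 + y 1 ^ 2) ≠ 0 := hr.ne'
  have hN : y 0 ^ 2 + y 1 ^ 2 ≠ 0 := by
    intro h
    apply hr0
    rw [h, Real.sqrt_zero]
  have h : HasFDerivAt taubesR _ y :=
    (((closed_hasFDerivAt_coord 0 y).pow 2).fun_add ((closed_hasFDerivAt_coord 1 y).pow 2)).sqrt hN
  refine ⟨h.differentiableAt, fun u => ?_⟩
  rw [h.fderiv]
  simp only [smul_apply, add_apply, PiLp.proj_apply, smul_eq_mul, nsmul_eq_mul, Nat.cast_ofNat,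
    Nat.add_one_sub_one, pow_one]
  rw [taubesDa, taubesR]
  field_simp

/-- Off the axis, `x ↦ da_x(v)` is differentiable, with
`∂_u da(v) = (u₀v₀ + u₁v₁)/r − (y₀v₀ + y₁v₁) da(u)/r²`. [folklore] -/
private theorem closed_fderiv_taubesDa (y : EuclideanSpace ℝ (Fin 4)) (hr : 0 < taubesR y)
    (v : EuclideanSpace ℝ (Fin 4)) :
    DifferentiableAt ℝ (fun x => taubesDa x v) y ∧
    ∀ u, fderiv ℝ (fun x => taubesDa x v) y u =
      (u 0 * v 0 + u 1 * v 1) / taubesR y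
        - (y 0 * v 0 + y 1 * v 1) * taubesDa y u / taubesR y ^ 2 := by
  obtain ⟨hRd, hRf⟩ := closed_fderiv_taubesR y hr
  have hr0 : taubesR y ≠ 0 := hr.ne'
  have hfun : (fun x => taubesDa x v) =
      fun x : EuclideanSpace ℝ (Fin 4) => (x 0 * v 0 + x 1 * v 1) * (taubesR x)⁻¹ := by
    funext x
    rw [taubesDa, div_eq_mul_inv]
  have hinv : HasFDerivAt (fun x : EuclideanSpace ℝ (Fin 4) => (taubesR x)⁻¹) _ y :=
    (hasDerivAt_inv hr0).comp_hasFDerivAt y hRd.hasFDerivAt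
  have h : HasFDerivAt
      (fun x : EuclideanSpace ℝ (Fin 4) => (x 0 * v 0 + x 1 * v 1) * (taubesR x)⁻¹) _ y :=
    (((closed_hasFDerivAt_coord 0 y).mul_const (v 0)).fun_add
      ((closed_hasFDerivAt_coord 1 y).mul_const (v 1))).fun_mul hinv
  rw [hfun]
  refine ⟨h.differentiableAt, fun u => ?_⟩
  rw [h.fderiv]
  simp only [smul_apply, add_apply, PiLp.proj_apply, smul_eq_mul]
  rw [hRf u, taubesDa]
  field_simp
  ring

/-- Off the axis, `x ↦ dt_x(v) = (x₀v₁ − x₁v₀)/(x₀² + x₁²)` is differentiable, with an explicit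
(rational) derivative. [folklore] -/
private theorem closed_fderiv_taubesDt (y : EuclideanSpace ℝ (Fin 4)) (hr : 0 < taubesR y)
    (v : EuclideanSpace ℝ (Fin 4)) :
    DifferentiableAt ℝ (fun x => taubesDt x v) y ∧
    ∀ u, fderiv ℝ (fun x => taubesDt x v) y u =
      (u 0 * v 1 - u 1 * v 0) / (y 0 ^ 2 + y 1 ^ 2)
        - (y 0 * v 1 - y 1 * v 0) * (2 * (y 0 * u 0 + y 1 * u 1)) / (y 0 ^ 2 + y 1 ^ 2) ^ 2 := by
  have hr0 : Real.sqrt (y 0 ^ 2 + y 1 ^ 2) ≠ 0 := hr.ne'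
  have hN : y 0 ^ 2 + y 1 ^ 2 ≠ 0 := by
    intro h
    apply hr0
    rw [h, Real.sqrt_zero]
  have hfun : (fun x => taubesDt x v) =
      fun x : EuclideanSpace ℝ (Fin 4) => (x 0 * v 1 - x 1 * v 0) * (x 0 ^ 2 + x 1 ^ 2)⁻¹ := by
    funext x
    rw [taubesDt, taubesR, Real.sq_sqrt (add_nonneg (sq_nonneg (x 0)) (sq_nonneg (x 1))),
      div_eq_mul_inv]
  have hNd : HasFDerivAt (fun x : EuclideanSpace ℝ (Fin 4) => x 0 ^ 2 + x 1 ^ 2) _ y :=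
    ((closed_hasFDerivAt_coord 0 y).pow 2).fun_add ((closed_hasFDerivAt_coord 1 y).pow 2)
  have hinv : HasFDerivAt (fun x : EuclideanSpace ℝ (Fin 4) => (x 0 ^ 2 + x 1 ^ 2)⁻¹) _ y :=
    (hasDerivAt_inv hN).comp_hasFDerivAt y hNd
  have h : HasFDerivAt (fun x : EuclideanSpace ℝ (Fin 4) =>
      (x 0 * v 1 - x 1 * v 0) * (x 0 ^ 2 + x 1 ^ 2)⁻¹) _ y :=
    (((closed_hasFDerivAt_coord 0 y).mul_const (v 1)).fun_sub
      ((closed_hasFDerivAt_coord 1 y).mul_const (v 0))).fun_mul hinv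
  rw [hfun]
  refine ⟨h.differentiableAt, fun u => ?_⟩
  rw [h.fderiv]
  simp only [smul_apply, add_apply, sub_apply, PiLp.proj_apply, smul_eq_mul, nsmul_eq_mul,
    Nat.cast_ofNat, Nat.add_one_sub_one, pow_one]
  field_simp
  ring

/-- Off the axis, `x ↦ dQ_x(v)` is differentiable, with
`∂_u dQ(v) = da(u) da(v) + (r − 1) ∂_u da(v) + u₂v₂ − 2u₃v₃`. [folklore] -/
private theorem closed_fderiv_taubesDQ (y : EuclideanSpace ℝ (Fin 4)) (hr : 0 < taubesR y)
    (v : EuclideanSpace ℝ (Fin 4)) :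
    DifferentiableAt ℝ (fun x => taubesDQ x v) y ∧
    ∀ u, fderiv ℝ (fun x => taubesDQ x v) y u =
      taubesDa y u * taubesDa y v + (taubesR y - 1) * fderiv ℝ (fun x => taubesDa x v) y u
        + u 2 * v 2 - 2 * u 3 * v 3 := by
  obtain ⟨hRd, hRf⟩ := closed_fderiv_taubesR y hr
  obtain ⟨hAd, -⟩ := closed_fderiv_taubesDa y hr v
  have h : HasFDerivAt (fun x => taubesDQ x v) _ y :=
    (((hRd.hasFDerivAt.sub_const 1).fun_mul hAd.hasFDerivAt).fun_add
      ((closed_hasFDerivAt_coord 2 y).mul_const (v 2))).fun_sub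
      (((closed_hasFDerivAt_coord 3 y).const_mul 2).mul_const (v 3))
  refine ⟨h.differentiableAt, fun u => ?_⟩
  rw [h.fderiv]
  simp only [smul_apply, add_apply, sub_apply, PiLp.proj_apply, smul_eq_mul]
  rw [hRf u]
  ring

/-! ### The three symmetries: `dt`, `da`, `dQ` are closed -/

/-- `∂_a dt(b) = ∂_b dt(a)` off the axis (`dt = d arg` is closed). [folklore] -/
private theorem closed_taubesDt_symm (y : EuclideanSpace ℝ (Fin 4)) (hr : 0 < taubesR y)
    (a b : EuclideanSpace ℝ (Fin 4)) :
    fderiv ℝ (fun x => taubesDt x b) y a = fderiv ℝ (fun x => taubesDt x a) y b := by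
  have hr0 : Real.sqrt (y 0 ^ 2 + y 1 ^ 2) ≠ 0 := hr.ne'
  have hN : y 0 ^ 2 + y 1 ^ 2 ≠ 0 := by
    intro h
    apply hr0
    rw [h, Real.sqrt_zero]
  rw [(closed_fderiv_taubesDt y hr b).2 a, (closed_fderiv_taubesDt y hr a).2 b]
  field_simp
  ring

/-- `∂_a da(b) = ∂_b da(a)` off the axis (`da = dr` is exact). [folklore] -/
private theorem closed_taubesDa_symm (y : EuclideanSpace ℝ (Fin 4)) (hr : 0 < taubesR y)
    (a b : EuclideanSpace ℝ (Fin 4)) :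
    fderiv ℝ (fun x => taubesDa x b) y a = fderiv ℝ (fun x => taubesDa x a) y b := by
  have hr0 : taubesR y ≠ 0 := hr.ne'
  rw [(closed_fderiv_taubesDa y hr b).2 a, (closed_fderiv_taubesDa y hr a).2 b, taubesDa, taubesDa]
  field_simp

/-- `∂_a dQ(b) = ∂_b dQ(a)` off the axis (`dQ` is exact). [folklore] -/
private theorem closed_taubesDQ_symm (y : EuclideanSpace ℝ (Fin 4)) (hr : 0 < taubesR y)
    (a b : EuclideanSpace ℝ (Fin 4)) :
    fderiv ℝ (fun x => taubesDQ x b) y a = fderiv ℝ (fun x => taubesDQ x a) y b := by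
  rw [(closed_fderiv_taubesDQ y hr b).2 a, (closed_fderiv_taubesDQ y hr a).2 b,
    closed_taubesDa_symm y hr a b]
  ring

/-! ### The derivative of `ωT` through the block derivatives -/

/-- Product rule: `∂_u ωT(v, w)` in terms of the block values and block derivatives at `y`
(with `∂_u r` already replaced by `da(u)`). [folklore] -/
private theorem closed_fderiv_taubesForm (y : EuclideanSpace ℝ (Fin 4)) (hr : 0 < taubesR y)
    (v w : EuclideanSpace ℝ (Fin 4)) :
    DifferentiableAt ℝ (fun x => taubesForm x v w) y ∧
    ∀ u, fderiv ℝ (fun x => taubesForm x v w) y u =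
      fderiv ℝ (fun x => taubesDt x v) y u * taubesDQ y w
          + taubesDt y v * fderiv ℝ (fun x => taubesDQ x w) y u
        - (fderiv ℝ (fun x => taubesDt x w) y u * taubesDQ y v
          + taubesDt y w * fderiv ℝ (fun x => taubesDQ x v) y u)
        + taubesDa y u * (v 2 * w 3 - w 2 * v 3)
        + (u 2 * (v 3 * taubesDa y w - w 3 * taubesDa y v)
          + y 2 * (v 3 * fderiv ℝ (fun x => taubesDa x w) y u
            - w 3 * fderiv ℝ (fun x => taubesDa x v) y u))
        - (2 * u 3 * (taubesDa y v * w 2 - taubesDa y w * v 2)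
          + 2 * y 3 * (fderiv ℝ (fun x => taubesDa x v) y u * w 2
            - fderiv ℝ (fun x => taubesDa x w) y u * v 2)) := by
  obtain ⟨hRd, hRf⟩ := closed_fderiv_taubesR y hr
  have hT := fun c => (closed_fderiv_taubesDt y hr c).1
  have hA := fun c => (closed_fderiv_taubesDa y hr c).1
  have hQ := fun c => (closed_fderiv_taubesDQ y hr c).1
  have h : HasFDerivAt (fun x => taubesForm x v w) _ y :=
    (((((hT v).hasFDerivAt.fun_mul (hQ w).hasFDerivAt).fun_sub
        ((hT w).hasFDerivAt.fun_mul (hQ v).hasFDerivAt)).fun_add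
        ((hRd.hasFDerivAt.sub_const 1).mul_const (v 2 * w 3 - w 2 * v 3))).fun_add
        ((closed_hasFDerivAt_coord 2 y).fun_mul
          (((hA w).hasFDerivAt.const_mul (v 3)).fun_sub
            ((hA v).hasFDerivAt.const_mul (w 3))))).fun_sub
      (((closed_hasFDerivAt_coord 3 y).const_mul 2).fun_mul
        (((hA v).hasFDerivAt.mul_const (w 2)).fun_sub ((hA w).hasFDerivAt.mul_const (v 2))))
  refine ⟨h.differentiableAt, fun u => ?_⟩
  rw [h.fderiv]
  simp only [smul_apply, add_apply, sub_apply, PiLp.proj_apply, smul_eq_mul]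
  rw [hRf u]
  ring

/-! ### Closedness -/

/-- **`dωT = 0` on the Taubes tube** (Taubes 1998, §1: `ωT = dt ∧ dQ + ⋆₃dQ` is closed since `Q` is
`g_tor`-harmonic): for `0 < δ < 1`, `y ∈ taubesTube δ` and constant vector fields `u, v, w`,
`∂_u ωT(v, w) − ∂_v ωT(u, w) + ∂_w ωT(u, v) = 0`. [folklore] -/
theorem helper_taubesForm_closed : ∀ (δ : ℝ) (y : EuclideanSpace ℝ (Fin 4)), 0 < δ → δ < 1 → y ∈ taubesTube δ → ∀ u v w : EuclideanSpace ℝ (Fin 4), fderiv ℝ (fun x => taubesForm x v w) y u - fderiv ℝ (fun x => taubesForm x u w) y v + fderiv ℝ (fun x => taubesForm x u v) y w = 0 := by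
  intro δ y hδ0 hδ hy u v w
  have hr : 0 < taubesR y := closed_taubesR_pos δ y hδ0 hδ hy
  rw [(closed_fderiv_taubesForm y hr v w).2 u, (closed_fderiv_taubesForm y hr u w).2 v,
    (closed_fderiv_taubesForm y hr u v).2 w]
  have hT := closed_taubesDt_symm y hr
  have hD := closed_taubesDa_symm y hr
  have hQ := closed_taubesDQ_symm y hr
  linear_combination (taubesDQ y w) * hT u v + (taubesDQ y v) * hT w u + (taubesDQ y u) * hT v w
    + (taubesDt y v) * hQ u w + (taubesDt y w) * hQ v u + (taubesDt y u) * hQ w v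
    + (y 2 * v 3) * hD u w + (y 2 * w 3) * hD v u + (y 2 * u 3) * hD w v
    - (2 * y 3 * w 2) * hD u v - (2 * y 3 * v 2) * hD w u - (2 * y 3 * u 2) * hD v w

end Summit.SmoothPoincare4.SmoothPoincare4.Cruxes.HyperbolicEnd.TaubesCirclePencil

end
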